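import Summits.BirchSwinnertonDyer.BirchSwinnertonDyer.Theorems.Rank2ObservatoryPadicAtlasKit
import Summits.BirchSwinnertonDyer.BirchSwinnertonDyer.Theorems.Rank2ObservatoryKrausMinimality
import HarnessLib

/-!
# Rank-2 observatory — `p`-adic atlas kit, minimality test with the Tate–Kraus step at `2`

HONEST FRAMING: per-curve certified theorems and census instruments; no claim on BSD in rank ≥ 2.

Extension of the atlas kit `Rank2ObservatoryPadicAtlasKit.lean` (append-only, so in a separate file)
by a second kernel-evaluable global-minimality test `AtlasCurve.minCheck₂`: `Δ ≠ 0`, `|Δ| < B¹²`,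
`2⁸ ∤ |c₄|`, `2⁸ ∤ |c₆ + 64|`, and `q¹² ∤ |Δ| ∨ q ∤ |c₄|` for every `3 ≤ q < B`; soundness
`AtlasCurve.isGloballyMinimal₂` from `isGloballyMinimal_baseChange_int_of_kraus`
(`Rank2ObservatoryKrausMinimality.lean`: Kraus's necessary condition at `2` decides the minimality at
`2` of the `22` census models with `2⁴ ∣ c₄`, `2¹² ∣ Δ` that the `c₄`/`Δ` criterion `minCheck` leaves
open), and the table accessor `AtlasCurve.check_of_all₂`. No `sorry`, no new axioms.

References: A. Kraus, Acta Arith. 54 (1989), Prop. 2; J. Silverman, AEC (2009), VII.1, VIII.8;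
J. Cremona, Algorithms for Modular Elliptic Curves (1997), §3.2.
-/

-- single-conjunct summit: `Summit.BirchSwinnertonDyer.BirchSwinnertonDyer.…` repeats the name by design
set_option linter.dupNamespace false

namespace Summit.BirchSwinnertonDyer.BirchSwinnertonDyer.Rank2Observatory

open WeierstrassCurve Literature.NumberTheory.EllipticCurves

namespace AtlasCurve

variable (C : AtlasCurve)

/-- **The finite global-minimality criterion with the Tate–Kraus step at `2`**: `Δ ≠ 0`,
`|Δ| < B¹²`, `2⁸ ∤ |c₄|`, `2⁸ ∤ |c₆ + 64|` (Kraus at `2`), and `q¹² ∤ |Δ| ∨ q ∤ |c₄|` for all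
`3 ≤ q < B` (which implies it for the odd primes `q < B`). [cite: Kraus1989, Prop. 2] -/
def minCheck₂ : Bool :=
  decide (C.e.Δ ≠ 0) && decide (C.e.Δ.natAbs < C.B ^ 12) &&
    !decide (2 ^ 8 ∣ C.e.c₄.natAbs) && !decide (2 ^ 8 ∣ (C.e.c₆ + 64).natAbs) &&
    (List.range C.B).all fun q =>
      decide (q < 3) || !decide (q ^ 12 ∣ C.e.Δ.natAbs) || !decide (q ∣ C.e.c₄.natAbs)

variable {C}

/-- A curve passing the Kraus-extended finite criterion has a globally minimal integer model.
[cite: Kraus1989, Prop. 2] [cite: SilvermanAEC2009, VII.1 Remark 1.1] -/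
theorem isGloballyMinimal₂ (h : C.minCheck₂ = true) : (C.e.baseChange ℚ).IsGloballyMinimal := by
  simp only [minCheck₂, Bool.and_eq_true, decide_eq_true_eq, List.all_eq_true, List.mem_range,
    Bool.or_eq_true, Bool.not_eq_true', decide_eq_false_iff_not] at h
  obtain ⟨⟨⟨⟨hΔ, hB⟩, h4⟩, h6⟩, hq⟩ := h
  obtain ⟨h4', h6'⟩ := kraus_two_of_natAbs C.e h4 h6
  refine isGloballyMinimal_baseChange_int_of_kraus _ h4' h6' <|
    forall_odd_not_pow_dvd_or_of_bound _ hB hΔ fun q hq' hprime hq2 => ?_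
  rcases hq q (Finset.mem_range.mp hq') with (hlt | h12) | h1
  · exfalso
    have h2 := hprime.two_le
    omega
  · exact Or.inl h12
  · exact Or.inr h1

/-- From a table theorem `atlas.all (check ∧ minCheck₂) = true` to the two tests of a member.
[folklore] -/
theorem check_of_all₂ {atlas : List AtlasCurve}
    (h : atlas.all (fun C => C.check && C.minCheck₂) = true) {C : AtlasCurve} (hC : C ∈ atlas) :
    C.check = true ∧ C.minCheck₂ = true := by
  simp only [List.all_eq_true, Bool.and_eq_true] at h
  exact h C hC

end AtlasCurve

end Summit.BirchSwinnertonDyer.BirchSwinnertonDyer.Rank2Observatory
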